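import Mathlib
import HarnessLib
import Summits.ResolutionOfSingularities.ResolutionOfSingularities.Theorems.WildQuotientsWildQuotientResolutionS1aQhAwayDatum
import Summits.ResolutionOfSingularities.ResolutionOfSingularities.Theorems.WildQuotientsWildQuotientResolutionS1aTaylor2
import Summits.ResolutionOfSingularities.ResolutionOfSingularities.Theorems.WildQuotientsWildQuotientResolutionS1aSymMemberGraph
import Summits.ResolutionOfSingularities.ResolutionOfSingularities.Theorems.WildQuotientsWildQuotientResolutionS1aSymChartModel
import Summits.ResolutionOfSingularities.ResolutionOfSingularities.Theorems.WildQuotientsWildQuotientResolutionS1aGraphShear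
import Summits.ResolutionOfSingularities.ResolutionOfSingularities.Theorems.WildQuotientsWildQuotientResolutionS1aA1ModelPins
import Summits.ResolutionOfSingularities.ResolutionOfSingularities.Theorems.WildQuotientsWildQuotientResolutionS1aModelTools

/-!
# S1a — K-LOC (α1): the GRAPH MEMBER on a producer chart of an R4 root OVER A LOCALISED BASE `L = k[x][1/hh]`

[OURS · L1 W4.5c · lead-1 g16; plan-1 RULINGS R-F15o/R-F15p — K-LOC brick (m4) towards ★ R4e-rational `graphTail_killsIn_two`; pattern
✓`exists_isPrincipalCentre_of_tmonoChart` (polynomial base) rewritten for the localised node `L = k[x₀..x₃][1/hh]` (`σ hh = hh`) of an invariant basic open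
`D(e⁻¹hh)` (✓`exists_rootNodeAway`) and an ABSTRACT pinned chart model `Φ : ChartRing ≃+* k[x_none, x′][1/q]` (✓`FreeModel.exists_chartFreeModelEquiv`)]
— NOT statements of the manuscript; counted 0; AI-level work, weaker than expert review. Crux stmt-ResolutionOfSingularities-17941 `CyclicQuotientFourfolds`,
line `s1a-logminvertex` v13 (`stub_reachLowerInFX`).

R4 LOCAL NORMAL FORM over `L`: `σ` fixes `x₀, x₂` and the constants, `σx₁ = x₁ + x₀`, `σx₃ = x₃ + t` (`t ∈ 𝒥_sh`), root `(x₀/1 : w 0, x₁/1 : w 1, x₂/1 : w 2)` with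
`w 0 = w 1 + sh`, `τ = sigmaAway σ`; a producer chart `ChartRing_y` (`y ∈ trace_dbar`, `τy = y`) with a PINNED model `Φ` (`Φ(a) = subst a`, `Φ s = x_none`, `Φ uᵢ′ = x′ᵢ`).
* ROWS of `τ′ = conj Φ σ_chart` from the pins alone: `qhc_rows_fixed` (`x_none, x′₀, x′₂`, constants), `qhc_row_one` (`x′₁ ↦ x′₁ + x_none^sh x′₀`), `qhc_row_three`
  (`x₃ ↦ x₃ + x_none^sh T′` whenever `subst t = x_none^sh T′`), `qhc_row_subst` (`σ`-fixed polynomials), `map_invSelf_of_map_algebraMap` (`q⁻¹` is fixed once `q/1` is);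
* `qhc_tail_eq` (`Φ t̂ = T′` in `k[x_none,x′][1/q]`, `q ≠ 0`), DEGREES `qhc_degree_u'` / `qhc_degree_tail`, `exists_veroneseNormalised_graphChartAway`;
* ★★ `GameFrame.GModel.exists_isPrincipalCentre_of_graphChartAway` — the GRAPH MEMBER `(x′₀ : 2, φ = x′₂ − G(x_none, x′₁) : 1; β = x_none^sh)` for a tail with
  `subst t = x_none^sh·(x′₂ − G(x_none, x′₁))`, `G ∈ k[X₀, X₁]` read on `(x_none, x′₁)`: row of `φ` by the Taylor lemma ✓`FreeModel.exists_map_eval₂_eq_of_shift`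
  (hunit `−∂₁G(x_none, x′₁)`, assumed a unit on the chart), K1′ by ✓`FreeModel.isRegular_away_X_graph`, then ✓`exists_isPrincipalCentre_of_symMemberGraph`.
-/

set_option linter.dupNamespace false

noncomputable section

open CategoryTheory AlgebraicGeometry MvPolynomial
open Literature.AlgebraicGeometry.Resolution
open scoped LaurentPolynomial
open Summit.ResolutionOfSingularities.ResolutionOfSingularities.Theorems.WildQuotientResolution.S1
open Summit.ResolutionOfSingularities.ResolutionOfSingularities.Theorems.WildQuotientResolution.S1.CoarseChart
open Summit.ResolutionOfSingularities.ResolutionOfSingularities.Theorems.WildQuotientResolution.S1.ProducerStep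
open Summit.ResolutionOfSingularities.ResolutionOfSingularities.Theorems.WildQuotientResolution.S1.ReesBigrading
open Summit.ResolutionOfSingularities.ResolutionOfSingularities.Theorems.WildQuotientResolution.S1.NodeTransport
open Summit.ResolutionOfSingularities.ResolutionOfSingularities.Theorems.WildQuotientResolution.S1.CobordantTransport
open Summit.ResolutionOfSingularities.ResolutionOfSingularities.Theorems.WildQuotientResolution.S1.NodeAway
open Summit.ResolutionOfSingularities.ResolutionOfSingularities.Theorems.WildQuotientResolution.S1.CentreAway
open Summit.ResolutionOfSingularities.ResolutionOfSingularities.Theorems.WildQuotientResolution.S1.FreeModel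
open Summit.ResolutionOfSingularities.ResolutionOfSingularities.Theorems.WildQuotientResolution.S1.NodeAtlas
open Summit.ResolutionOfSingularities.ResolutionOfSingularities.Theorems.WildQuotientResolution.S1.NpFrame
open Summit.ResolutionOfSingularities.ResolutionOfSingularities.Theorems.WildQuotientResolution.S1.BlowupCharts
open Summit.ResolutionOfSingularities.ResolutionOfSingularities.Theorems.WildQuotientResolution.S1.KillCert
open Summit.ResolutionOfSingularities.ResolutionOfSingularities.Theorems.WildQuotientResolution.S1.GameFrame.GModel

namespace Summit.ResolutionOfSingularities.ResolutionOfSingularities.Theorems.WildQuotientResolution.S1.KillCert.QhAway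

variable {k : Type} [Field k] (σ : MvPolynomial (Fin 4) k ≃+* MvPolynomial (Fin 4) k) (hC : ∀ a : k, σ (C a) = C a)
  (h0 : σ (X 0) = X 0) (h1 : σ (X 1) = X 1 + X 0) (h2 : σ (X 2) = X 2) (t₀ : MvPolynomial (Fin 4) k) (h3 : σ (X 3) = X 3 + t₀)
  (w : Fin 3 → ℕ) (sh : ℕ) (hw0 : w 0 = w 1 + sh) (hh : MvPolynomial (Fin 4) k) (hσh : σ hh = hh)
  {p : ℕ} (hp : 0 < p) (hσpL : ∀ y : (Localization.Away hh), (⇑(sigmaAway σ hσh))^[p] y = y)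
  (hσJ : ∀ n : ℕ, ((weightedFiltration (fun i => algebraMap (MvPolynomial (Fin 4) k) (Localization.Away hh) (X ((![0, 1, 2] : Fin 3 → Fin 4) i))) w).ideal n).map (sigmaAway σ hσh : (Localization.Away hh) →+* (Localization.Away hh)) ≤ (weightedFiltration (fun i => algebraMap (MvPolynomial (Fin 4) k) (Localization.Away hh) (X ((![0, 1, 2] : Fin 3 → Fin 4) i))) w).ideal n)
  {mg : ℕ} (mo : Fin mg → ℕ) (𝒜 : (Π j : Fin mg, ZMod (mo j)) → AddSubgroup (Localization.Away hh)) [GradedRing 𝒜]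
  (hf : ∀ i, (fun i => algebraMap (MvPolynomial (Fin 4) k) (Localization.Away hh) (X ((![0, 1, 2] : Fin 3 → Fin 4) i))) i ∈ 𝒜 ((fun _ => (0 : Π j : Fin mg, ZMod (mo j))) i))
  {dbar : ℕ} (y : ↥(𝒜 0)) (hy : y ∈ (traceFiltration 𝒜 (fun i => algebraMap (MvPolynomial (Fin 4) k) (Localization.Away hh) (X ((![0, 1, 2] : Fin 3 → Fin 4) i))) w).ideal dbar) (hσy : sigmaAway σ hσh (y : (Localization.Away hh)) = y)

/-- In `Localization.Away q`, a ring automorphism fixing `q/1` fixes `q⁻¹`. [folklore] -/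
theorem map_invSelf_of_map_algebraMap {R : Type*} [CommRing R] (q : R) (τ' : Localization.Away q ≃+* Localization.Away q)
    (hq : τ' (algebraMap R (Localization.Away q) q) = algebraMap R (Localization.Away q) q) :
    τ' (IsLocalization.Away.invSelf q) = IsLocalization.Away.invSelf q := by
  have h1 : algebraMap R (Localization.Away q) q * IsLocalization.Away.invSelf q = 1 := IsLocalization.Away.mul_invSelf q
  have h2 : algebraMap R (Localization.Away q) q * τ' (IsLocalization.Away.invSelf q) = 1 := by rw [← hq, ← map_mul, h1, map_one]
  calc τ' (IsLocalization.Away.invSelf q)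
      = τ' (IsLocalization.Away.invSelf q) * (algebraMap R (Localization.Away q) q * IsLocalization.Away.invSelf q) := by rw [h1, mul_one]
    _ = (algebraMap R (Localization.Away q) q * τ' (IsLocalization.Away.invSelf q)) * IsLocalization.Away.invSelf q := by ring
    _ = IsLocalization.Away.invSelf q := by rw [h2, one_mul]

/-! ## Rows of `τ′ = conj Φ σ_chart` on an abstract pinned chart model -/

section Rows

variable {P : Type} [CommRing P] [Algebra (MvPolynomial (Option (Fin 4)) k) P] (Φ : (ChartRing 𝒜 (fun i => algebraMap (MvPolynomial (Fin 4) k) (Localization.Away hh) (X ((![0, 1, 2] : Fin 3 → Fin 4) i))) w dbar y hy) ≃+* P)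
  (hΦa : ∀ a : (MvPolynomial (Fin 4) k), Φ (algebraMap ↥(cobordantAlgebra (fun i => algebraMap (MvPolynomial (Fin 4) k) (Localization.Away hh) (X ((![0, 1, 2] : Fin 3 → Fin 4) i))) w) (ChartRing 𝒜 (fun i => algebraMap (MvPolynomial (Fin 4) k) (Localization.Away hh) (X ((![0, 1, 2] : Fin 3 → Fin 4) i))) w dbar y hy) (algebraMap (Localization.Away hh) ↥(cobordantAlgebra (fun i => algebraMap (MvPolynomial (Fin 4) k) (Localization.Away hh) (X ((![0, 1, 2] : Fin 3 → Fin 4) i))) w) (algebraMap (MvPolynomial (Fin 4) k) (Localization.Away hh) a))) = (algebraMap (MvPolynomial (Option (Fin 4)) k) P) (cobordantAlgebra.subst k (![w 0, w 1, w 2, 0] : Fin 4 → ℕ) a))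
  (hΦs : Φ (algebraMap ↥(cobordantAlgebra (fun i => algebraMap (MvPolynomial (Fin 4) k) (Localization.Away hh) (X ((![0, 1, 2] : Fin 3 → Fin 4) i))) w) (ChartRing 𝒜 (fun i => algebraMap (MvPolynomial (Fin 4) k) (Localization.Away hh) (X ((![0, 1, 2] : Fin 3 → Fin 4) i))) w dbar y hy) (cobordantAlgebra.s (fun i => algebraMap (MvPolynomial (Fin 4) k) (Localization.Away hh) (X ((![0, 1, 2] : Fin 3 → Fin 4) i))) w)) = (algebraMap (MvPolynomial (Option (Fin 4)) k) P) (X none))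
  (hΦu : ∀ i : Fin 3, Φ (algebraMap ↥(cobordantAlgebra (fun i => algebraMap (MvPolynomial (Fin 4) k) (Localization.Away hh) (X ((![0, 1, 2] : Fin 3 → Fin 4) i))) w) (ChartRing 𝒜 (fun i => algebraMap (MvPolynomial (Fin 4) k) (Localization.Away hh) (X ((![0, 1, 2] : Fin 3 → Fin 4) i))) w dbar y hy) (cobordantAlgebra.u' (fun i => algebraMap (MvPolynomial (Fin 4) k) (Localization.Away hh) (X ((![0, 1, 2] : Fin 3 → Fin 4) i))) w i)) = (algebraMap (MvPolynomial (Option (Fin 4)) k) P) (X (some ((![0, 1, 2] : Fin 3 → Fin 4) i))))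

set_option maxHeartbeats 1600000 in
include hC h0 h1 h2 h3 hΦa hΦs hΦu in
/-- Rows: `τ′` FIXES `x_none`, `x′₀`, the invariant generator `x′₂` and the constants (one conjunction). -/
theorem qhc_rows_fixed :
    conj Φ (sigmaChart 𝒜 (fun i => algebraMap (MvPolynomial (Fin 4) k) (Localization.Away hh) (X ((![0, 1, 2] : Fin 3 → Fin 4) i))) w dbar y hy (sigmaAway σ hσh) hσJ hp hσpL hσy) ((algebraMap (MvPolynomial (Option (Fin 4)) k) P) (X none)) = (algebraMap (MvPolynomial (Option (Fin 4)) k) P) (X none) ∧ conj Φ (sigmaChart 𝒜 (fun i => algebraMap (MvPolynomial (Fin 4) k) (Localization.Away hh) (X ((![0, 1, 2] : Fin 3 → Fin 4) i))) w dbar y hy (sigmaAway σ hσh) hσJ hp hσpL hσy) ((algebraMap (MvPolynomial (Option (Fin 4)) k) P) (X (some 0))) = (algebraMap (MvPolynomial (Option (Fin 4)) k) P) (X (some 0)) ∧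
      conj Φ (sigmaChart 𝒜 (fun i => algebraMap (MvPolynomial (Fin 4) k) (Localization.Away hh) (X ((![0, 1, 2] : Fin 3 → Fin 4) i))) w dbar y hy (sigmaAway σ hσh) hσJ hp hσpL hσy) ((algebraMap (MvPolynomial (Option (Fin 4)) k) P) (X (some 2))) = (algebraMap (MvPolynomial (Option (Fin 4)) k) P) (X (some 2)) ∧ ∀ a : k, conj Φ (sigmaChart 𝒜 (fun i => algebraMap (MvPolynomial (Fin 4) k) (Localization.Away hh) (X ((![0, 1, 2] : Fin 3 → Fin 4) i))) w dbar y hy (sigmaAway σ hσh) hσJ hp hσpL hσy) ((algebraMap (MvPolynomial (Option (Fin 4)) k) P) (C a)) = (algebraMap (MvPolynomial (Option (Fin 4)) k) P) (C a) := by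
  obtain ⟨r0, -, r2, -⟩ := qhl_rows σ h0 h1 h2 t₀ h3 hh hσh
  refine ⟨?_, ?_, ?_, fun a => ?_⟩
  · rw [← hΦs, conj_apply_map, sigmaChart_algebraMap, sigmaR_s]
  · have hu := hΦu 0
    change _ = (algebraMap (MvPolynomial (Option (Fin 4)) k) P) (X (some 0)) at hu
    rw [← hu, conj_apply_map, sigmaChart_algebraMap, QhAbs.qha_sigmaR_u'_zero (sigmaAway σ hσh) (fun i => algebraMap (MvPolynomial (Fin 4) k) (Localization.Away hh) (X ((![0, 1, 2] : Fin 3 → Fin 4) i))) w r0 hp hσpL hσJ]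
  · have hu := hΦu 2
    change _ = (algebraMap (MvPolynomial (Option (Fin 4)) k) P) (X (some 2)) at hu
    rw [← hu, conj_apply_map, sigmaChart_algebraMap, QhAbs.qha_sigmaR_u'_two (sigmaAway σ hσh) (fun i => algebraMap (MvPolynomial (Fin 4) k) (Localization.Away hh) (X ((![0, 1, 2] : Fin 3 → Fin 4) i))) w r2 hp hσpL hσJ]
  · have hc : Φ (algebraMap ↥(cobordantAlgebra (fun i => algebraMap (MvPolynomial (Fin 4) k) (Localization.Away hh) (X ((![0, 1, 2] : Fin 3 → Fin 4) i))) w) (ChartRing 𝒜 (fun i => algebraMap (MvPolynomial (Fin 4) k) (Localization.Away hh) (X ((![0, 1, 2] : Fin 3 → Fin 4) i))) w dbar y hy) (algebraMap (Localization.Away hh) ↥(cobordantAlgebra (fun i => algebraMap (MvPolynomial (Fin 4) k) (Localization.Away hh) (X ((![0, 1, 2] : Fin 3 → Fin 4) i))) w) (algebraMap (MvPolynomial (Fin 4) k) (Localization.Away hh) (C a)))) = (algebraMap (MvPolynomial (Option (Fin 4)) k) P) (C a) := by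
      rw [hΦa, cobordantAlgebra.subst, MvPolynomial.eval₂Hom_C]
    rw [← hc, conj_apply_map, sigmaChart_algebraMap_algebraMap, sigmaAway_algebraMap, hC]

set_option maxHeartbeats 1600000 in
set_option synthInstance.maxHeartbeats 400000 in
include h0 h1 h2 h3 hw0 hΦs hΦu in
/-- Row: `τ′ x′₁ = x′₁ + x_none^sh · x′₀`. -/
theorem qhc_row_one :
    conj Φ (sigmaChart 𝒜 (fun i => algebraMap (MvPolynomial (Fin 4) k) (Localization.Away hh) (X ((![0, 1, 2] : Fin 3 → Fin 4) i))) w dbar y hy (sigmaAway σ hσh) hσJ hp hσpL hσy) ((algebraMap (MvPolynomial (Option (Fin 4)) k) P) (X (some 1))) = (algebraMap (MvPolynomial (Option (Fin 4)) k) P) (X (some 1)) + (algebraMap (MvPolynomial (Option (Fin 4)) k) P) (X none) ^ sh * (algebraMap (MvPolynomial (Option (Fin 4)) k) P) (X (some 0)) := by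
  obtain ⟨-, r1, -, -⟩ := qhl_rows σ h0 h1 h2 t₀ h3 hh hσh
  have hu1 := hΦu 1
  change _ = (algebraMap (MvPolynomial (Option (Fin 4)) k) P) (X (some 1)) at hu1
  have hu0 := hΦu 0
  change _ = (algebraMap (MvPolynomial (Option (Fin 4)) k) P) (X (some 0)) at hu0
  rw [← hu1, conj_apply_map, sigmaChart_algebraMap]
  have h := QhAbs.qha_sigmaR_u'_one_sub (sigmaAway σ hσh) (fun i => algebraMap (MvPolynomial (Fin 4) k) (Localization.Away hh) (X ((![0, 1, 2] : Fin 3 → Fin 4) i))) w sh r1 hw0 hp hσpL hσJ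
  rw [sub_eq_iff_eq_add] at h
  rw [h, map_add (algebraMap ↥(cobordantAlgebra (fun i => algebraMap (MvPolynomial (Fin 4) k) (Localization.Away hh) (X ((![0, 1, 2] : Fin 3 → Fin 4) i))) w) (ChartRing 𝒜 (fun i => algebraMap (MvPolynomial (Fin 4) k) (Localization.Away hh) (X ((![0, 1, 2] : Fin 3 → Fin 4) i))) w dbar y hy)), map_add Φ, map_mul (algebraMap ↥(cobordantAlgebra (fun i => algebraMap (MvPolynomial (Fin 4) k) (Localization.Away hh) (X ((![0, 1, 2] : Fin 3 → Fin 4) i))) w) (ChartRing 𝒜 (fun i => algebraMap (MvPolynomial (Fin 4) k) (Localization.Away hh) (X ((![0, 1, 2] : Fin 3 → Fin 4) i))) w dbar y hy)), map_mul Φ, map_pow (algebraMap ↥(cobordantAlgebra (fun i => algebraMap (MvPolynomial (Fin 4) k) (Localization.Away hh) (X ((![0, 1, 2] : Fin 3 → Fin 4) i))) w) (ChartRing 𝒜 (fun i => algebraMap (MvPolynomial (Fin 4) k) (Localization.Away hh) (X ((![0, 1, 2] : Fin 3 → Fin 4) i))) w dbar y hy)), map_pow Φ, hu1, hu0, hΦ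s,
    add_comm]

set_option maxHeartbeats 1600000 in
set_option synthInstance.maxHeartbeats 400000 in
include h3 hΦa in
/-- Row (general tail): `τ′ x₃ = x₃ + x_none^sh · T′` whenever `subst t = x_none^sh · T′`. -/
theorem qhc_row_three (T' : (MvPolynomial (Option (Fin 4)) k)) (hT' : cobordantAlgebra.subst k (![w 0, w 1, w 2, 0] : Fin 4 → ℕ) t₀ = X none ^ sh * T') :
    conj Φ (sigmaChart 𝒜 (fun i => algebraMap (MvPolynomial (Fin 4) k) (Localization.Away hh) (X ((![0, 1, 2] : Fin 3 → Fin 4) i))) w dbar y hy (sigmaAway σ hσh) hσJ hp hσpL hσy) ((algebraMap (MvPolynomial (Option (Fin 4)) k) P) (X (some 3))) = (algebraMap (MvPolynomial (Option (Fin 4)) k) P) (X (some 3)) + (algebraMap (MvPolynomial (Option (Fin 4)) k) P) (X none) ^ sh * (algebraMap (MvPolynomial (Option (Fin 4)) k) P) T' := by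
  have hx3 : Φ (algebraMap ↥(cobordantAlgebra (fun i => algebraMap (MvPolynomial (Fin 4) k) (Localization.Away hh) (X ((![0, 1, 2] : Fin 3 → Fin 4) i))) w) (ChartRing 𝒜 (fun i => algebraMap (MvPolynomial (Fin 4) k) (Localization.Away hh) (X ((![0, 1, 2] : Fin 3 → Fin 4) i))) w dbar y hy) (algebraMap (Localization.Away hh) ↥(cobordantAlgebra (fun i => algebraMap (MvPolynomial (Fin 4) k) (Localization.Away hh) (X ((![0, 1, 2] : Fin 3 → Fin 4) i))) w) (algebraMap (MvPolynomial (Fin 4) k) (Localization.Away hh) (X 3)))) = (algebraMap (MvPolynomial (Option (Fin 4)) k) P) (X (some 3)) := by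
    rw [hΦa, cobordantAlgebra.subst, MvPolynomial.eval₂Hom_X']
    simp
  rw [← hx3, conj_apply_map, sigmaChart_algebraMap_algebraMap, sigmaAway_algebraMap, h3, map_add (algebraMap (MvPolynomial (Fin 4) k) (Localization.Away hh)), map_add (algebraMap (Localization.Away hh) ↥(cobordantAlgebra (fun i => algebraMap (MvPolynomial (Fin 4) k) (Localization.Away hh) (X ((![0, 1, 2] : Fin 3 → Fin 4) i))) w)),
    map_add (algebraMap ↥(cobordantAlgebra (fun i => algebraMap (MvPolynomial (Fin 4) k) (Localization.Away hh) (X ((![0, 1, 2] : Fin 3 → Fin 4) i))) w) (ChartRing 𝒜 (fun i => algebraMap (MvPolynomial (Fin 4) k) (Localization.Away hh) (X ((![0, 1, 2] : Fin 3 → Fin 4) i))) w dbar y hy)), map_add Φ, hx3, hΦa, hT', map_mul, map_pow]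

set_option maxHeartbeats 800000 in
include hΦa in
/-- Row: `τ′` fixes `subst a` for every `σ`-fixed polynomial `a` (e.g. `a = hh`). -/
theorem qhc_row_subst (a : (MvPolynomial (Fin 4) k)) (ha : σ a = a) :
    conj Φ (sigmaChart 𝒜 (fun i => algebraMap (MvPolynomial (Fin 4) k) (Localization.Away hh) (X ((![0, 1, 2] : Fin 3 → Fin 4) i))) w dbar y hy (sigmaAway σ hσh) hσJ hp hσpL hσy) ((algebraMap (MvPolynomial (Option (Fin 4)) k) P) (cobordantAlgebra.subst k (![w 0, w 1, w 2, 0] : Fin 4 → ℕ) a)) = (algebraMap (MvPolynomial (Option (Fin 4)) k) P) (cobordantAlgebra.subst k (![w 0, w 1, w 2, 0] : Fin 4 → ℕ) a) := by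
  rw [← hΦa, conj_apply_map, sigmaChart_algebraMap_algebraMap, sigmaAway_algebraMap, ha]

/-! ### Degrees relative to `θ = consIndexEquiv mo (1, 0)` -/

include hΦu in
/-- `x′ᵢ` has degree `(w i) • θ` in the transported grading. -/
theorem qhc_degree_u' (i : Fin 3) :
    letI := chartNodeGradedRing mo 𝒜 (fun i => algebraMap (MvPolynomial (Fin 4) k) (Localization.Away hh) (X ((![0, 1, 2] : Fin 3 → Fin 4) i))) w hf dbar y hy
    (algebraMap (MvPolynomial (Option (Fin 4)) k) P) (X (some ((![0, 1, 2] : Fin 3 → Fin 4) i))) ∈ mapGrading (chartNodeGrading mo 𝒜 (fun i => algebraMap (MvPolynomial (Fin 4) k) (Localization.Away hh) (X ((![0, 1, 2] : Fin 3 → Fin 4) i))) w hf dbar y hy) Φ ((w i) • (consIndexEquiv mo ((1 : ℤ), (0 : Π j : Fin mg, ZMod (mo j))))) := by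
  letI := chartNodeGradedRing mo 𝒜 (fun i => algebraMap (MvPolynomial (Fin 4) k) (Localization.Away hh) (X ((![0, 1, 2] : Fin 3 → Fin 4) i))) w hf dbar y hy
  rw [← hΦu i, map_mem_mapGrading_iff]
  have h := algebraMap_mem_chartNodeGrading mo 𝒜 (fun i => algebraMap (MvPolynomial (Fin 4) k) (Localization.Away hh) (X ((![0, 1, 2] : Fin 3 → Fin 4) i))) w hf dbar y hy (u'_mem_reesPiece 𝒜 (fun i => algebraMap (MvPolynomial (Fin 4) k) (Localization.Away hh) (X ((![0, 1, 2] : Fin 3 → Fin 4) i))) (δ := fun _ => 0) w hf i)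
  have hidx : consIndexEquiv mo ((((w i : ℕ)) : ℤ), (fun _ : Fin 3 => (0 : Π j : Fin mg, ZMod (mo j))) i) = (w i) • (consIndexEquiv mo ((1 : ℤ), (0 : Π j : Fin mg, ZMod (mo j)))) :=
    consIndexEquiv_nat_zero mo (w i)
  rw [hidx] at h
  exact h

omit [Algebra (MvPolynomial (Option (Fin 4)) k) P] in
/-- `Φ t̂` has degree `sh • θ` for a degree-0 tail `t`. -/
theorem qhc_degree_tail (ht : algebraMap (MvPolynomial (Fin 4) k) (Localization.Away hh) t₀ ∈ (weightedFiltration (fun i => algebraMap (MvPolynomial (Fin 4) k) (Localization.Away hh) (X ((![0, 1, 2] : Fin 3 → Fin 4) i))) w).ideal sh) (ht0 : algebraMap (MvPolynomial (Fin 4) k) (Localization.Away hh) t₀ ∈ 𝒜 0) :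
    letI := chartNodeGradedRing mo 𝒜 (fun i => algebraMap (MvPolynomial (Fin 4) k) (Localization.Away hh) (X ((![0, 1, 2] : Fin 3 → Fin 4) i))) w hf dbar y hy
    Φ (algebraMap ↥(cobordantAlgebra (fun i => algebraMap (MvPolynomial (Fin 4) k) (Localization.Away hh) (X ((![0, 1, 2] : Fin 3 → Fin 4) i))) w) (ChartRing 𝒜 (fun i => algebraMap (MvPolynomial (Fin 4) k) (Localization.Away hh) (X ((![0, 1, 2] : Fin 3 → Fin 4) i))) w dbar y hy) ⟨_, C_mul_T_mem_cobordantAlgebra _ _ ht⟩) ∈ mapGrading (chartNodeGrading mo 𝒜 (fun i => algebraMap (MvPolynomial (Fin 4) k) (Localization.Away hh) (X ((![0, 1, 2] : Fin 3 → Fin 4) i))) w hf dbar y hy) Φ (sh • (consIndexEquiv mo ((1 : ℤ), (0 : Π j : Fin mg, ZMod (mo j))))) := by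
  letI := chartNodeGradedRing mo 𝒜 (fun i => algebraMap (MvPolynomial (Fin 4) k) (Localization.Away hh) (X ((![0, 1, 2] : Fin 3 → Fin 4) i))) w hf dbar y hy
  rw [map_mem_mapGrading_iff]
  have h := algebraMap_mem_chartNodeGrading mo 𝒜 (fun i => algebraMap (MvPolynomial (Fin 4) k) (Localization.Away hh) (X ((![0, 1, 2] : Fin 3 → Fin 4) i))) w hf dbar y hy (mk_mem_reesPiece 𝒜 (fun i => algebraMap (MvPolynomial (Fin 4) k) (Localization.Away hh) (X ((![0, 1, 2] : Fin 3 → Fin 4) i))) w ht0 (C_mul_T_mem_cobordantAlgebra _ _ ht))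
  rw [consIndexEquiv_nat_zero mo sh] at h
  exact h

include hΦu in
/-- **A Veronese degree for a member centre `(x′₀, φ′)`** with `φ′` homogeneous of degree `sh • θ`, on a producer chart over `L`. -/
theorem exists_veroneseNormalised_graphChartAway
    (htame : letI := chartNodeGradedRing mo 𝒜 (fun i => algebraMap (MvPolynomial (Fin 4) k) (Localization.Away hh) (X ((![0, 1, 2] : Fin 3 → Fin 4) i))) w hf dbar y hy; IsTameNode p (ChartRing 𝒜 (fun i => algebraMap (MvPolynomial (Fin 4) k) (Localization.Away hh) (X ((![0, 1, 2] : Fin 3 → Fin 4) i))) w dbar y hy) (chartNodeGrading mo 𝒜 (fun i => algebraMap (MvPolynomial (Fin 4) k) (Localization.Away hh) (X ((![0, 1, 2] : Fin 3 → Fin 4) i))) w hf dbar y hy) (sigmaChart 𝒜 (fun i => algebraMap (MvPolynomial (Fin 4) k) (Localization.Away hh) (X ((![0, 1, 2] : Fin 3 → Fin 4) i))) w dbar y hy (sigmaAway σ hσh) hσJ hp hσpL hσy))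
    (φ' : P) (hφ' : letI := chartNodeGradedRing mo 𝒜 (fun i => algebraMap (MvPolynomial (Fin 4) k) (Localization.Away hh) (X ((![0, 1, 2] : Fin 3 → Fin 4) i))) w hf dbar y hy; φ' ∈ mapGrading (chartNodeGrading mo 𝒜 (fun i => algebraMap (MvPolynomial (Fin 4) k) (Localization.Away hh) (X ((![0, 1, 2] : Fin 3 → Fin 4) i))) w hf dbar y hy) Φ (sh • (consIndexEquiv mo ((1 : ℤ), (0 : Π j : Fin mg, ZMod (mo j)))))) (w' : Fin 2 → ℕ) :
    letI := chartNodeGradedRing mo 𝒜 (fun i => algebraMap (MvPolynomial (Fin 4) k) (Localization.Away hh) (X ((![0, 1, 2] : Fin 3 → Fin 4) i))) w hf dbar y hy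
    letI := mapGradedRing (chartNodeGrading mo 𝒜 (fun i => algebraMap (MvPolynomial (Fin 4) k) (Localization.Away hh) (X ((![0, 1, 2] : Fin 3 → Fin 4) i))) w hf dbar y hy) Φ
    ∃ d : ℕ, VeroneseNormalised (mapGrading (chartNodeGrading mo 𝒜 (fun i => algebraMap (MvPolynomial (Fin 4) k) (Localization.Away hh) (X ((![0, 1, 2] : Fin 3 → Fin 4) i))) w hf dbar y hy) Φ) (![(algebraMap (MvPolynomial (Option (Fin 4)) k) P) (X (some 0)), φ'] : Fin 2 → P) w' d := by
  letI instN := chartNodeGradedRing mo 𝒜 (fun i => algebraMap (MvPolynomial (Fin 4) k) (Localization.Away hh) (X ((![0, 1, 2] : Fin 3 → Fin 4) i))) w hf dbar y hy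
  letI instP := mapGradedRing (chartNodeGrading mo 𝒜 (fun i => algebraMap (MvPolynomial (Fin 4) k) (Localization.Away hh) (X ((![0, 1, 2] : Fin 3 → Fin 4) i))) w hf dbar y hy) Φ
  have htameT := isTameNode_map (chartNodeGrading mo 𝒜 (fun i => algebraMap (MvPolynomial (Fin 4) k) (Localization.Away hh) (X ((![0, 1, 2] : Fin 3 → Fin 4) i))) w hf dbar y hy) Φ p _ htame
  exact Veronese.veroneseNormalisation _ _ _ htameT.2.2.2.1 2 _ ![(w 0) • (consIndexEquiv mo ((1 : ℤ), (0 : Π j : Fin mg, ZMod (mo j)))), sh • (consIndexEquiv mo ((1 : ℤ), (0 : Π j : Fin mg, ZMod (mo j))))] w'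
    (fun i => by fin_cases i; exacts [qhc_degree_u' w hh mo 𝒜 hf y hy Φ hΦu 0, hφ'])

end Rows

/-! ## The tail pin in a localised free model `k[x_none, x′][1/q]` -/

set_option maxHeartbeats 1600000 in
set_option synthInstance.maxHeartbeats 400000 in
/-- **Tail pin**: `Φ t̂ = T′` in `k[x_none, x′][1/q]` (`q ≠ 0`) whenever `subst t = x_none^sh · T′`. -/
theorem qhc_tail_eq {qd : (MvPolynomial (Option (Fin 4)) k)} (hq0 : qd ≠ 0) (Φ : (ChartRing 𝒜 (fun i => algebraMap (MvPolynomial (Fin 4) k) (Localization.Away hh) (X ((![0, 1, 2] : Fin 3 → Fin 4) i))) w dbar y hy) ≃+* (Localization.Away qd))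
    (hΦa : ∀ a : (MvPolynomial (Fin 4) k), Φ (algebraMap ↥(cobordantAlgebra (fun i => algebraMap (MvPolynomial (Fin 4) k) (Localization.Away hh) (X ((![0, 1, 2] : Fin 3 → Fin 4) i))) w) (ChartRing 𝒜 (fun i => algebraMap (MvPolynomial (Fin 4) k) (Localization.Away hh) (X ((![0, 1, 2] : Fin 3 → Fin 4) i))) w dbar y hy) (algebraMap (Localization.Away hh) ↥(cobordantAlgebra (fun i => algebraMap (MvPolynomial (Fin 4) k) (Localization.Away hh) (X ((![0, 1, 2] : Fin 3 → Fin 4) i))) w) (algebraMap (MvPolynomial (Fin 4) k) (Localization.Away hh) a))) = (algebraMap (MvPolynomial (Option (Fin 4)) k) (Localization.Away qd)) (cobordantAlgebra.subst k (![w 0, w 1, w 2, 0] : Fin 4 → ℕ) a))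
    (hΦs : Φ (algebraMap ↥(cobordantAlgebra (fun i => algebraMap (MvPolynomial (Fin 4) k) (Localization.Away hh) (X ((![0, 1, 2] : Fin 3 → Fin 4) i))) w) (ChartRing 𝒜 (fun i => algebraMap (MvPolynomial (Fin 4) k) (Localization.Away hh) (X ((![0, 1, 2] : Fin 3 → Fin 4) i))) w dbar y hy) (cobordantAlgebra.s (fun i => algebraMap (MvPolynomial (Fin 4) k) (Localization.Away hh) (X ((![0, 1, 2] : Fin 3 → Fin 4) i))) w)) = (algebraMap (MvPolynomial (Option (Fin 4)) k) (Localization.Away qd)) (X none))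
    (ht : algebraMap (MvPolynomial (Fin 4) k) (Localization.Away hh) t₀ ∈ (weightedFiltration (fun i => algebraMap (MvPolynomial (Fin 4) k) (Localization.Away hh) (X ((![0, 1, 2] : Fin 3 → Fin 4) i))) w).ideal sh) (T' : (MvPolynomial (Option (Fin 4)) k)) (hT' : cobordantAlgebra.subst k (![w 0, w 1, w 2, 0] : Fin 4 → ℕ) t₀ = X none ^ sh * T') :
    Φ (algebraMap ↥(cobordantAlgebra (fun i => algebraMap (MvPolynomial (Fin 4) k) (Localization.Away hh) (X ((![0, 1, 2] : Fin 3 → Fin 4) i))) w) (ChartRing 𝒜 (fun i => algebraMap (MvPolynomial (Fin 4) k) (Localization.Away hh) (X ((![0, 1, 2] : Fin 3 → Fin 4) i))) w dbar y hy) ⟨_, C_mul_T_mem_cobordantAlgebra _ _ ht⟩) = (algebraMap (MvPolynomial (Option (Fin 4)) k) (Localization.Away qd)) T' := by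
  haveI : IsDomain (Localization.Away qd) := IsLocalization.isDomain_localization (powers_le_nonZeroDivisors_of_noZeroDivisors hq0)
  have hRw : cobordantAlgebra.s (fun i => algebraMap (MvPolynomial (Fin 4) k) (Localization.Away hh) (X ((![0, 1, 2] : Fin 3 → Fin 4) i))) w ^ sh * ⟨_, C_mul_T_mem_cobordantAlgebra _ _ ht⟩ = algebraMap (Localization.Away hh) ↥(cobordantAlgebra (fun i => algebraMap (MvPolynomial (Fin 4) k) (Localization.Away hh) (X ((![0, 1, 2] : Fin 3 → Fin 4) i))) w) (algebraMap (MvPolynomial (Fin 4) k) (Localization.Away hh) t₀) := by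
    refine Subtype.ext ?_
    rw [MulMemClass.coe_mul, cobordantAlgebra.coe_s_pow, cobordantAlgebra.coe_algebraMap]
    change LaurentPolynomial.T (-((sh : ℕ) : ℤ)) * (LaurentPolynomial.C (algebraMap (MvPolynomial (Fin 4) k) (Localization.Away hh) t₀) * LaurentPolynomial.T ((sh : ℕ) : ℤ)) = _
    rw [mul_left_comm, ← LaurentPolynomial.T_add, neg_add_cancel, LaurentPolynomial.T_zero, mul_one]
  have h : Φ (algebraMap ↥(cobordantAlgebra (fun i => algebraMap (MvPolynomial (Fin 4) k) (Localization.Away hh) (X ((![0, 1, 2] : Fin 3 → Fin 4) i))) w) (ChartRing 𝒜 (fun i => algebraMap (MvPolynomial (Fin 4) k) (Localization.Away hh) (X ((![0, 1, 2] : Fin 3 → Fin 4) i))) w dbar y hy) (cobordantAlgebra.s (fun i => algebraMap (MvPolynomial (Fin 4) k) (Localization.Away hh) (X ((![0, 1, 2] : Fin 3 → Fin 4) i))) w ^ sh * ⟨_, C_mul_T_mem_cobordantAlgebra _ _ ht⟩)) = (algebraMap (MvPolynomial (Option (Fin 4)) k) (Localization.Away qd)) (X none ^ sh * T') := by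
    rw [hRw, hΦa, hT']
  rw [map_mul (algebraMap ↥(cobordantAlgebra (fun i => algebraMap (MvPolynomial (Fin 4) k) (Localization.Away hh) (X ((![0, 1, 2] : Fin 3 → Fin 4) i))) w) (ChartRing 𝒜 (fun i => algebraMap (MvPolynomial (Fin 4) k) (Localization.Away hh) (X ((![0, 1, 2] : Fin 3 → Fin 4) i))) w dbar y hy)), map_mul Φ, map_pow (algebraMap ↥(cobordantAlgebra (fun i => algebraMap (MvPolynomial (Fin 4) k) (Localization.Away hh) (X ((![0, 1, 2] : Fin 3 → Fin 4) i))) w) (ChartRing 𝒜 (fun i => algebraMap (MvPolynomial (Fin 4) k) (Localization.Away hh) (X ((![0, 1, 2] : Fin 3 → Fin 4) i))) w dbar y hy)), map_pow Φ, hΦs, map_mul (algebraMap (MvPolynomial (Option (Fin 4)) k) (Localization.Away qd)), map_pow (algebraMap (MvPolynomial (Option (Fin 4)) k) (Localization.Away qd))] at h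
  have hne : (algebraMap (MvPolynomial (Option (Fin 4)) k) (Localization.Away qd)) (X none) ≠ 0 := fun h0' =>
    MvPolynomial.X_ne_zero none (IsLocalization.injective (Localization.Away qd) (powers_le_nonZeroDivisors_of_noZeroDivisors hq0) (by rw [h0', map_zero]))
  exact mul_left_cancel₀ (pow_ne_zero _ hne) h

end Summit.ResolutionOfSingularities.ResolutionOfSingularities.Theorems.WildQuotientResolution.S1.KillCert.QhAway

/-! ## The graph member on a producer chart over `L` -/

namespace Summit.ResolutionOfSingularities.ResolutionOfSingularities.Theorems.WildQuotientResolution.S1.GameFrame.GModel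

variable {p : ℕ} {X' X₁ : Scheme.{0}} {q : X' ⟶ X₁} {G : Type} [Group G] {ρ : G →* Aut X'} {g₀ : G}

set_option maxHeartbeats 8000000 in
set_option synthInstance.maxHeartbeats 400000 in
/-- ★★ **THE GRAPH MEMBER ON A PRODUCER CHART OF AN R4 ROOT OVER THE LOCALISED BASE `L = k[x][1/hh]`**: component `V(x′₀, x′₂ − G(x_none, x′₁))`,
weights `(2, 1)`, `β = x_none^sh`, for a tail with `subst t = x_none^sh·(x′₂ − G(x_none, x′₁))`; the pinned chart model is `Φ : ChartRing ≃ k[x_none,x′][1/q]`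
(`q ≠ 0`, `τ′(q/1) = q/1`), `−∂₁G` a unit on the chart, and a `k`-point `(0; 0, 1, G(0,1), 0)` of the component off `q = 0`. See the module docstring.
[OURS · L1 W4.5c · K-LOC (α1) brick (m4); NOT a statement of the manuscript] -/
theorem exists_isPrincipalCentre_of_graphChartAway [Finite G] (hG : ∀ g : G, g ∈ Subgroup.zpowers g₀)
    {k : Type} [Field k] (σ : MvPolynomial (Fin 4) k ≃+* MvPolynomial (Fin 4) k) (hC : ∀ a : k, σ (C a) = C a)
    (h0 : σ (X 0) = X 0) (h1 : σ (X 1) = X 1 + X 0) (h2 : σ (X 2) = X 2) (t₀ : MvPolynomial (Fin 4) k) (h3 : σ (X 3) = X 3 + t₀)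
    (w : Fin 3 → ℕ) (sh : ℕ) (hw0 : w 0 = w 1 + sh)
    (ht₀ : t₀ ∈ (weightedFiltration (fun i => (X ((![0, 1, 2] : Fin 3 → Fin 4) i) : MvPolynomial (Fin 4) k)) w).ideal sh)
    (hh : MvPolynomial (Fin 4) k) (hσh : σ hh = hh)
    (hp : 0 < p) (hσpL : ∀ y : (Localization.Away hh), (⇑(sigmaAway σ hσh))^[p] y = y)
    (hσJ : ∀ n : ℕ, ((weightedFiltration (fun i => algebraMap (MvPolynomial (Fin 4) k) (Localization.Away hh) (X ((![0, 1, 2] : Fin 3 → Fin 4) i))) w).ideal n).map (sigmaAway σ hσh : (Localization.Away hh) →+* (Localization.Away hh)) ≤ (weightedFiltration (fun i => algebraMap (MvPolynomial (Fin 4) k) (Localization.Away hh) (X ((![0, 1, 2] : Fin 3 → Fin 4) i))) w).ideal n)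
    {mg : ℕ} (mo : Fin mg → ℕ) (𝒜 : (Π j : Fin mg, ZMod (mo j)) → AddSubgroup (Localization.Away hh)) [GradedRing 𝒜]
    (hf : ∀ i, (fun i => algebraMap (MvPolynomial (Fin 4) k) (Localization.Away hh) (X ((![0, 1, 2] : Fin 3 → Fin 4) i))) i ∈ 𝒜 ((fun _ => (0 : Π j : Fin mg, ZMod (mo j))) i)) (ht0A : algebraMap (MvPolynomial (Fin 4) k) (Localization.Away hh) t₀ ∈ 𝒜 0)
    {dbar : ℕ} (y : ↥(𝒜 0)) (hy : y ∈ (traceFiltration 𝒜 (fun i => algebraMap (MvPolynomial (Fin 4) k) (Localization.Away hh) (X ((![0, 1, 2] : Fin 3 → Fin 4) i))) w).ideal dbar) (hσy : sigmaAway σ hσh (y : (Localization.Away hh)) = y)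
    -- the pinned chart model
    (qd : (MvPolynomial (Option (Fin 4)) k)) (hq0 : qd ≠ 0) (Φ : (ChartRing 𝒜 (fun i => algebraMap (MvPolynomial (Fin 4) k) (Localization.Away hh) (X ((![0, 1, 2] : Fin 3 → Fin 4) i))) w dbar y hy) ≃+* (Localization.Away qd))
    (hΦa : ∀ a : (MvPolynomial (Fin 4) k), Φ (algebraMap ↥(cobordantAlgebra (fun i => algebraMap (MvPolynomial (Fin 4) k) (Localization.Away hh) (X ((![0, 1, 2] : Fin 3 → Fin 4) i))) w) (ChartRing 𝒜 (fun i => algebraMap (MvPolynomial (Fin 4) k) (Localization.Away hh) (X ((![0, 1, 2] : Fin 3 → Fin 4) i))) w dbar y hy) (algebraMap (Localization.Away hh) ↥(cobordantAlgebra (fun i => algebraMap (MvPolynomial (Fin 4) k) (Localization.Away hh) (X ((![0, 1, 2] : Fin 3 → Fin 4) i))) w) (algebraMap (MvPolynomial (Fin 4) k) (Localization.Away hh) a))) = (algebraMap (MvPolynomial (Option (Fin 4)) k) (Localization.Away qd)) (cobordantAlgebra.subst k (![w 0, w 1, w 2, 0] : Fin 4 → ℕ) a))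
    (hΦs : Φ (algebraMap ↥(cobordantAlgebra (fun i => algebraMap (MvPolynomial (Fin 4) k) (Localization.Away hh) (X ((![0, 1, 2] : Fin 3 → Fin 4) i))) w) (ChartRing 𝒜 (fun i => algebraMap (MvPolynomial (Fin 4) k) (Localization.Away hh) (X ((![0, 1, 2] : Fin 3 → Fin 4) i))) w dbar y hy) (cobordantAlgebra.s (fun i => algebraMap (MvPolynomial (Fin 4) k) (Localization.Away hh) (X ((![0, 1, 2] : Fin 3 → Fin 4) i))) w)) = (algebraMap (MvPolynomial (Option (Fin 4)) k) (Localization.Away qd)) (X none))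
    (hΦu : ∀ i : Fin 3, Φ (algebraMap ↥(cobordantAlgebra (fun i => algebraMap (MvPolynomial (Fin 4) k) (Localization.Away hh) (X ((![0, 1, 2] : Fin 3 → Fin 4) i))) w) (ChartRing 𝒜 (fun i => algebraMap (MvPolynomial (Fin 4) k) (Localization.Away hh) (X ((![0, 1, 2] : Fin 3 → Fin 4) i))) w dbar y hy) (cobordantAlgebra.u' (fun i => algebraMap (MvPolynomial (Fin 4) k) (Localization.Away hh) (X ((![0, 1, 2] : Fin 3 → Fin 4) i))) w i)) = (algebraMap (MvPolynomial (Option (Fin 4)) k) (Localization.Away qd)) (X (some ((![0, 1, 2] : Fin 3 → Fin 4) i))))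
    (hτq : conj Φ (sigmaChart 𝒜 (fun i => algebraMap (MvPolynomial (Fin 4) k) (Localization.Away hh) (X ((![0, 1, 2] : Fin 3 → Fin 4) i))) w dbar y hy (sigmaAway σ hσh) hσJ hp hσpL hσy) ((algebraMap (MvPolynomial (Option (Fin 4)) k) (Localization.Away qd)) qd) = (algebraMap (MvPolynomial (Option (Fin 4)) k) (Localization.Away qd)) qd)
    -- the graph tail
    (Gq : MvPolynomial (Fin 2) k) (hT' : cobordantAlgebra.subst k (![w 0, w 1, w 2, 0] : Fin 4 → ℕ) t₀ = X none ^ sh * (X (some 2) - rename (![none, some 1] : Fin 2 → Option (Fin 4)) Gq))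
    (hGu : IsUnit ((algebraMap (MvPolynomial (Option (Fin 4)) k) (Localization.Away qd)) (rename (![none, some 1] : Fin 2 → Option (Fin 4)) (pderiv 1 Gq))))
    (hu : MvPolynomial.eval (fun o : Option (Fin 4) => o.elim (0 : k) ![0, 1, MvPolynomial.eval ![0, 1] Gq, 0]) qd ≠ 0)
    -- the chart and its producer node
    (M : GModel p q G ρ g₀) [M.V.IsSeparated] (W : M.act.StableAffineOpens) (hW : IsAffineOpen W.1)
    (E : letI := chartNodeGradedRing mo 𝒜 (fun i => algebraMap (MvPolynomial (Fin 4) k) (Localization.Away hh) (X ((![0, 1, 2] : Fin 3 → Fin 4) i))) w hf dbar y hy; Γ(M.V, W.1) ≃+* ↥((chartNodeGrading mo 𝒜 (fun i => algebraMap (MvPolynomial (Fin 4) k) (Localization.Away hh) (X ((![0, 1, 2] : Fin 3 → Fin 4) i))) w hf dbar y hy) 0))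
    (htame : letI := chartNodeGradedRing mo 𝒜 (fun i => algebraMap (MvPolynomial (Fin 4) k) (Localization.Away hh) (X ((![0, 1, 2] : Fin 3 → Fin 4) i))) w hf dbar y hy; IsTameNode p (ChartRing 𝒜 (fun i => algebraMap (MvPolynomial (Fin 4) k) (Localization.Away hh) (X ((![0, 1, 2] : Fin 3 → Fin 4) i))) w dbar y hy) (chartNodeGrading mo 𝒜 (fun i => algebraMap (MvPolynomial (Fin 4) k) (Localization.Away hh) (X ((![0, 1, 2] : Fin 3 → Fin 4) i))) w hf dbar y hy) (sigmaChart 𝒜 (fun i => algebraMap (MvPolynomial (Fin 4) k) (Localization.Away hh) (X ((![0, 1, 2] : Fin 3 → Fin 4) i))) w dbar y hy (sigmaAway σ hσh) hσJ hp hσpL hσy))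
    (hE : letI := chartNodeGradedRing mo 𝒜 (fun i => algebraMap (MvPolynomial (Fin 4) k) (Localization.Away hh) (X ((![0, 1, 2] : Fin 3 → Fin 4) i))) w hf dbar y hy
      ∀ t' : Γ(M.V, W.1), ((E ((M.act.aut g₀⁻¹).hom.appLE W.1 W.1 (W.2.1 g₀⁻¹).ge t') : ↥((chartNodeGrading mo 𝒜 (fun i => algebraMap (MvPolynomial (Fin 4) k) (Localization.Away hh) (X ((![0, 1, 2] : Fin 3 → Fin 4) i))) w hf dbar y hy) 0)) : (ChartRing 𝒜 (fun i => algebraMap (MvPolynomial (Fin 4) k) (Localization.Away hh) (X ((![0, 1, 2] : Fin 3 → Fin 4) i))) w dbar y hy)) = (sigmaChart 𝒜 (fun i => algebraMap (MvPolynomial (Fin 4) k) (Localization.Away hh) (X ((![0, 1, 2] : Fin 3 → Fin 4) i))) w dbar y hy (sigmaAway σ hσh) hσJ hp hσpL hσy) ((E t' : ↥((chartNodeGrading mo 𝒜 (fun i => algebraMap (MvPolynomial (Fin 4) k) (Localization.Away hh) (X ((![0, 1, 2] : Fin 3 → Fin 4) i))) w hf dbar y hy) 0)) : (ChartRing 𝒜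 (fun i => algebraMap (MvPolynomial (Fin 4) k) (Localization.Away hh) (X ((![0, 1, 2] : Fin 3 → Fin 4) i))) w dbar y hy)))
    -- the Veronese degree
    (d : ℕ) (l : ℕ) (hl : 0 < l)
    (hver : letI := chartNodeGradedRing mo 𝒜 (fun i => algebraMap (MvPolynomial (Fin 4) k) (Localization.Away hh) (X ((![0, 1, 2] : Fin 3 → Fin 4) i))) w hf dbar y hy; letI := mapGradedRing (chartNodeGrading mo 𝒜 (fun i => algebraMap (MvPolynomial (Fin 4) k) (Localization.Away hh) (X ((![0, 1, 2] : Fin 3 → Fin 4) i))) w hf dbar y hy) Φ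
      VeroneseNormalised (mapGrading (chartNodeGrading mo 𝒜 (fun i => algebraMap (MvPolynomial (Fin 4) k) (Localization.Away hh) (X ((![0, 1, 2] : Fin 3 → Fin 4) i))) w hf dbar y hy) Φ) (![(algebraMap (MvPolynomial (Option (Fin 4)) k) (Localization.Away qd)) (X (some 0)), (algebraMap (MvPolynomial (Option (Fin 4)) k) (Localization.Away qd)) (X (some 2) - rename (![none, some 1] : Fin 2 → Option (Fin 4)) Gq)] : Fin 2 → (Localization.Away qd)) ![2, 1] d)
    -- separating sections
    {κ : Type} (U : κ → M.V.Opens) (hcov : ∀ x : M.V, x ∈ W.1 ∨ ∃ i, x ∈ U i) (u : κ → Γ(M.V, W.1)) (nu : κ → ℕ) (hnu : ∀ i, 0 < nu i)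
    (huJ : letI := chartNodeGradedRing mo 𝒜 (fun i => algebraMap (MvPolynomial (Fin 4) k) (Localization.Away hh) (X ((![0, 1, 2] : Fin 3 → Fin 4) i))) w hf dbar y hy
      ∀ i, Φ ((E (u i) : ↥((chartNodeGrading mo 𝒜 (fun i => algebraMap (MvPolynomial (Fin 4) k) (Localization.Away hh) (X ((![0, 1, 2] : Fin 3 → Fin 4) i))) w hf dbar y hy) 0)) : (ChartRing 𝒜 (fun i => algebraMap (MvPolynomial (Fin 4) k) (Localization.Away hh) (X ((![0, 1, 2] : Fin 3 → Fin 4) i))) w dbar y hy)) ∈ (weightedFiltration (![(algebraMap (MvPolynomial (Option (Fin 4)) k) (Localization.Away qd)) (X (some 0)), (algebraMap (MvPolynomial (Option (Fin 4)) k) (Localization.Away qd)) (X (some 2) - rename (![none, some 1] : Fin 2 → Option (Fin 4)) Gq)] : Fin 2 → (Localization.Away qd)) ![2, 1]).ideal (nu i))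
    (huU : ∀ i, ∀ x ∈ W.1, x ∈ U i → x ∈ M.V.basicOpen (u i)) :
    letI := chartNodeGradedRing mo 𝒜 (fun i => algebraMap (MvPolynomial (Fin 4) k) (Localization.Away hh) (X ((![0, 1, 2] : Fin 3 → Fin 4) i))) w hf dbar y hy
    letI := mapGradedRing (chartNodeGrading mo 𝒜 (fun i => algebraMap (MvPolynomial (Fin 4) k) (Localization.Away hh) (X ((![0, 1, 2] : Fin 3 → Fin 4) i))) w hf dbar y hy) Φ
    ∃ J : ReesFiltration M.V, IsPrincipalCentre p M.act g₀ J (d * l) ∧ IsPrincipalCentreChart p M.act g₀ J (d * l) W ∧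
      (((J.ideal (d * l)).support : Set M.V)) ⊆ (W.1 : Set M.V) ∧ (∀ i, Disjoint ((U i : Set M.V)) (((J.ideal (d * l)).support : Set M.V))) ∧
      ∀ n, (J.filtration ⟨W.1, hW⟩).ideal n =
        ((traceFiltration (mapGrading (chartNodeGrading mo 𝒜 (fun i => algebraMap (MvPolynomial (Fin 4) k) (Localization.Away hh) (X ((![0, 1, 2] : Fin 3 → Fin 4) i))) w hf dbar y hy) Φ) (![(algebraMap (MvPolynomial (Option (Fin 4)) k) (Localization.Away qd)) (X (some 0)), (algebraMap (MvPolynomial (Option (Fin 4)) k) (Localization.Away qd)) (X (some 2) - rename (![none, some 1] : Fin 2 → Option (Fin 4)) Gq)] : Fin 2 → (Localization.Away qd)) ![2, 1]).ideal n).comap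
          ((E.trans (zeroRingEquiv (chartNodeGrading mo 𝒜 (fun i => algebraMap (MvPolynomial (Fin 4) k) (Localization.Away hh) (X ((![0, 1, 2] : Fin 3 → Fin 4) i))) w hf dbar y hy) Φ) : Γ(M.V, W.1) ≃+* _) : Γ(M.V, W.1) →+* _) := by
  letI instN := chartNodeGradedRing mo 𝒜 (fun i => algebraMap (MvPolynomial (Fin 4) k) (Localization.Away hh) (X ((![0, 1, 2] : Fin 3 → Fin 4) i))) w hf dbar y hy
  letI instP := mapGradedRing (chartNodeGrading mo 𝒜 (fun i => algebraMap (MvPolynomial (Fin 4) k) (Localization.Away hh) (X ((![0, 1, 2] : Fin 3 → Fin 4) i))) w hf dbar y hy) Φ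
  have hver' := CoarseChart.veroneseNormalised_mul _ _ _ hver hl
  have ht : algebraMap (MvPolynomial (Fin 4) k) (Localization.Away hh) t₀ ∈ (weightedFiltration (fun i => algebraMap (MvPolynomial (Fin 4) k) (Localization.Away hh) (X ((![0, 1, 2] : Fin 3 → Fin 4) i))) w).ideal sh := KillCert.QhAway.qhl_tail_mem t₀ w sh ht₀ hh
  -- rows of `τ′ = conj Φ σ_chart`
  obtain ⟨rn, r0, r2, rC⟩ := KillCert.QhAway.qhc_rows_fixed σ hC h0 h1 h2 t₀ h3 w hh hσh hp hσpL hσJ mo 𝒜 y hy hσy Φ hΦa hΦs hΦu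
  have r1 := KillCert.QhAway.qhc_row_one σ h0 h1 h2 t₀ h3 w sh hw0 hh hσh hp hσpL hσJ mo 𝒜 y hy hσy Φ hΦs hΦu
  have r3 := KillCert.QhAway.qhc_row_three σ t₀ h3 w sh hh hσh hp hσpL hσJ mo 𝒜 y hy hσy Φ hΦa (X (some 2) - rename (![none, some 1] : Fin 2 → Option (Fin 4)) Gq) hT'
  have hφeq := KillCert.QhAway.qhc_tail_eq t₀ w sh hh mo 𝒜 y hy hq0 Φ hΦa hΦs ht (X (some 2) - rename (![none, some 1] : Fin 2 → Option (Fin 4)) Gq) hT'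
  -- polynomials in `(x_none, x′₁)` read in the model
  have halg : ∀ r : (MvPolynomial (Option (Fin 4)) k), (algebraMap (MvPolynomial (Option (Fin 4)) k) (Localization.Away qd)) r = eval₂ (algebraMap k (Localization.Away qd)) (fun o => (algebraMap (MvPolynomial (Option (Fin 4)) k) (Localization.Away qd)) (X o)) r := fun r => by
    conv_lhs => rw [← MvPolynomial.eval₂_eta r]
    rw [MvPolynomial.eval₂_comp_left, IsScalarTower.algebraMap_eq k (MvPolynomial (Option (Fin 4)) k) (Localization.Away qd), MvPolynomial.algebraMap_eq]
    rfl
  have hev : ∀ Q : MvPolynomial (Fin 2) k, (algebraMap (MvPolynomial (Option (Fin 4)) k) (Localization.Away qd)) (rename (![none, some 1] : Fin 2 → Option (Fin 4)) Q) = eval₂ (algebraMap k (Localization.Away qd)) (![(algebraMap (MvPolynomial (Option (Fin 4)) k) (Localization.Away qd)) (X none), (algebraMap (MvPolynomial (Option (Fin 4)) k) (Localization.Away qd)) (X (some 1))] : Fin 2 → (Localization.Away qd)) Q := fun Q => by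
    rw [halg, MvPolynomial.eval₂_rename]
    congr 1
    funext i
    fin_cases i <;> rfl
  -- the Taylor expansion of the row of `G(x_none, x′₁)`
  obtain ⟨R, hR⟩ := FreeModel.exists_map_eval₂_eq_of_shift (algebraMap k (Localization.Away qd)) (![(algebraMap (MvPolynomial (Option (Fin 4)) k) (Localization.Away qd)) (X none), (algebraMap (MvPolynomial (Option (Fin 4)) k) (Localization.Away qd)) (X (some 1))] : Fin 2 → (Localization.Away qd)) 1
    ((algebraMap (MvPolynomial (Option (Fin 4)) k) (Localization.Away qd)) (X none) ^ sh * (algebraMap (MvPolynomial (Option (Fin 4)) k) (Localization.Away qd)) (X (some 0))) ((conj Φ (sigmaChart 𝒜 (fun i => algebraMap (MvPolynomial (Fin 4) k) (Localization.Away hh) (X ((![0, 1, 2] : Fin 3 → Fin 4) i))) w dbar y hy (sigmaAway σ hσh) hσJ hp hσpL hσy) : (Localization.Away qd) ≃+* (Localization.Away qd)) : (Localization.Away qd) →+* (Localization.Away qd))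
    (fun a => by rw [RingHom.coe_coe, IsScalarTower.algebraMap_apply k (MvPolynomial (Option (Fin 4)) k) (Localization.Away qd) a, MvPolynomial.algebraMap_eq]; exact rC a)
    (by rw [RingHom.coe_coe]; exact r1)
    (fun j hj => by
      fin_cases j
      · rw [RingHom.coe_coe]; exact rn
      · exact absurd rfl hj) Gq
  rw [RingHom.coe_coe] at hR
  -- the component `φ = x′₂ − G`: row
  have hφrow : conj Φ (sigmaChart 𝒜 (fun i => algebraMap (MvPolynomial (Fin 4) k) (Localization.Away hh) (X ((![0, 1, 2] : Fin 3 → Fin 4) i))) w dbar y hy (sigmaAway σ hσh) hσJ hp hσpL hσy) ((algebraMap (MvPolynomial (Option (Fin 4)) k) (Localization.Away qd)) (X (some 2) - rename (![none, some 1] : Fin 2 → Option (Fin 4)) Gq)) =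
      (algebraMap (MvPolynomial (Option (Fin 4)) k) (Localization.Away qd)) (X (some 2) - rename (![none, some 1] : Fin 2 → Option (Fin 4)) Gq) + (algebraMap (MvPolynomial (Option (Fin 4)) k) (Localization.Away qd)) (X none) ^ sh * (algebraMap (MvPolynomial (Option (Fin 4)) k) (Localization.Away qd)) (X (some 0)) * (-((algebraMap (MvPolynomial (Option (Fin 4)) k) (Localization.Away qd)) (rename (![none, some 1] : Fin 2 → Option (Fin 4)) (pderiv 1 Gq)))) +
        ((algebraMap (MvPolynomial (Option (Fin 4)) k) (Localization.Away qd)) (X none) ^ sh * (algebraMap (MvPolynomial (Option (Fin 4)) k) (Localization.Away qd)) (X (some 0))) ^ 2 * (-R) := by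
    rw [map_sub, map_sub, r2, hev Gq, hR, hev (pderiv 1 Gq)]
    ring
  -- K1′ by the graph shear
  obtain ⟨hK1, hK1'⟩ := FreeModel.isRegular_away_X_graph k qd (some 0) (some 2) (by decide) (rename (![none, some 1] : Fin 2 → Option (Fin 4)) Gq)
    (fun f hf' => by
      have hfv : (f ∘ (![none, some 1] : Fin 2 → Option (Fin 4))) = (X ∘ (![none, some 1] : Fin 2 → Option (Fin 4))) := by
        funext i
        fin_cases i
        exacts [hf' none (by decide), hf' (some 1) (by decide)]
      rw [MvPolynomial.aeval_rename, hfv, ← MvPolynomial.aeval_rename, MvPolynomial.aeval_X_left_apply])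
    (fun o : Option (Fin 4) => o.elim (0 : k) ![0, 1, MvPolynomial.eval ![0, 1] Gq, 0]) rfl
    (by
      have hpv : ((fun o : Option (Fin 4) => o.elim (0 : k) ![0, 1, MvPolynomial.eval ![0, 1] Gq, 0]) ∘ (![none, some 1] : Fin 2 → Option (Fin 4))) = ![0, 1] := by
        funext i
        fin_cases i <;> rfl
      rw [MvPolynomial.eval_rename, hpv]
      rfl) hu
  -- `τ′` fixes `q⁻¹` and the constants
  have hfix : ∀ g' ∈ (({IsLocalization.Away.invSelf qd} : Set (Localization.Away qd)) ∪ Set.range (algebraMap k (Localization.Away qd))), conj Φ (sigmaChart 𝒜 (fun i => algebraMap (MvPolynomial (Fin 4) k) (Localization.Away hh) (X ((![0, 1, 2] : Fin 3 → Fin 4) i))) w dbar y hy (sigmaAway σ hσh) hσJ hp hσpL hσy) g' = g' := by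
    rintro g' (hg | ⟨a, rfl⟩)
    · rw [Set.mem_singleton_iff.mp hg]
      exact KillCert.QhAway.map_invSelf_of_map_algebraMap qd _ hτq
    · rw [IsScalarTower.algebraMap_apply k (MvPolynomial (Option (Fin 4)) k) (Localization.Away qd) a, MvPolynomial.algebraMap_eq]
      exact rC a
  -- degrees
  have dg0 := KillCert.QhAway.qhc_degree_u' w hh mo 𝒜 hf y hy Φ hΦu 0
  have hφd : (algebraMap (MvPolynomial (Option (Fin 4)) k) (Localization.Away qd)) (X (some 2) - rename (![none, some 1] : Fin 2 → Option (Fin 4)) Gq) ∈ mapGrading (chartNodeGrading mo 𝒜 (fun i => algebraMap (MvPolynomial (Fin 4) k) (Localization.Away hh) (X ((![0, 1, 2] : Fin 3 → Fin 4) i))) w hf dbar y hy) Φ (sh • (consIndexEquiv mo ((1 : ℤ), (0 : Π j : Fin mg, ZMod (mo j))))) := by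
    rw [← hφeq]
    exact KillCert.QhAway.qhc_degree_tail t₀ w sh hh mo 𝒜 hf y hy Φ ht ht0A
  exact exists_isPrincipalCentre_of_symMemberGraph hG M W
    ({ affine := hW, m := mg + 1, r := Fin.cons 0 mo, B := (ChartRing 𝒜 (fun i => algebraMap (MvPolynomial (Fin 4) k) (Localization.Away hh) (X ((![0, 1, 2] : Fin 3 → Fin 4) i))) w dbar y hy), 𝒜 := (chartNodeGrading mo 𝒜 (fun i => algebraMap (MvPolynomial (Fin 4) k) (Localization.Away hh) (X ((![0, 1, 2] : Fin 3 → Fin 4) i))) w hf dbar y hy), σ := (sigmaChart 𝒜 (fun i => algebraMap (MvPolynomial (Fin 4) k) (Localization.Away hh) (X ((![0, 1, 2] : Fin 3 → Fin 4) i))) w dbar y hy (sigmaAway σ hσh) hσJ hp hσpL hσy), e := E, tame := htame, intertwine := hE } : NodeData p M.act g₀ W)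
    Φ (conj Φ (sigmaChart 𝒜 (fun i => algebraMap (MvPolynomial (Fin 4) k) (Localization.Away hh) (X ((![0, 1, 2] : Fin 3 → Fin 4) i))) w dbar y hy (sigmaAway σ hσh) hσJ hp hσpL hσy)) (fun _ => rfl)
    ((algebraMap (MvPolynomial (Option (Fin 4)) k) (Localization.Away qd)) (X none)) ((algebraMap (MvPolynomial (Option (Fin 4)) k) (Localization.Away qd)) (X (some 0))) ((algebraMap (MvPolynomial (Option (Fin 4)) k) (Localization.Away qd)) (X (some 1))) ((algebraMap (MvPolynomial (Option (Fin 4)) k) (Localization.Away qd)) (X (some 2))) ((algebraMap (MvPolynomial (Option (Fin 4)) k) (Localization.Away qd)) (X (some 3)))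
    ((algebraMap (MvPolynomial (Option (Fin 4)) k) (Localization.Away qd)) (X (some 2) - rename (![none, some 1] : Fin 2 → Option (Fin 4)) Gq)) ((algebraMap (MvPolynomial (Option (Fin 4)) k) (Localization.Away qd)) (X (some 2) - rename (![none, some 1] : Fin 2 → Option (Fin 4)) Gq))
    1 1 0 (-((algebraMap (MvPolynomial (Option (Fin 4)) k) (Localization.Away qd)) (rename (![none, some 1] : Fin 2 → Option (Fin 4)) (pderiv 1 Gq)))) (-R) sh _
    rn r0 (by rw [one_mul]; exact r1) (by rw [zero_mul, add_zero]; exact r2) r3 hφrow isUnit_one hGu.neg (one_mul _).symm isUnit_one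
    hfix (A1.a1_model_closure_eq_top _) hK1 hK1' _ _ dg0 hφd (d * l) (Nat.mul_pos hver.1 hl) hver' U hcov u nu hnu huJ huU

end Summit.ResolutionOfSingularities.ResolutionOfSingularities.Theorems.WildQuotientResolution.S1.GameFrame.GModel

end
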